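import Literature.NumberTheory.Rogawski1990.DepthZeroKappaTransferTypeOneGSideTraceClosed   -- ★ p852274 (C6)-6: the type-(1) G-side in the TRACE frame, CLOSED (every residue characteristic)
import Literature.NumberTheory.Rogawski1990.DepthZeroKappaTransferTypeOne                   -- ★ the tame clause (brings its ★ organs: O8c H-values, eigenframe, exponents, the near-1 locus, `charpoly_map_endoEmbLocal_apply`)
import Literature.NumberTheory.Rogawski1990.FlickerScalarsTraceCMSharp                       -- ★ `exists_traceFrame_scalars_of_nonsplit_sharp'` (trace datum with unit discriminant, any residue characteristic)
import HarnessLib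

/-!
# T3′ (P-1) at EVERY unramified non-split place: the depth-zero κ-transfer at the hyperspecial vertex, TYPE ONE, with `|2| = 1` deleted

Topic `NumberTheory/Rogawski1990`; namespace `Literature.NumberTheory.Rogawski1990`.  THEOREMS ONLY (no definition, no instance, no notation, no named fact, no `sorry`);
kernel lane `--supports stmt-HodgeConjecture-24833`.  Cell `pub/hodgecm-mathlib`, crux H413, half-A line LH4; the dyadic twin of T3′ clause (P-1), companion of the dyadic (P-2)
clause `DepthZeroKappaTransferTypeTwoDyadic` (this seat) on the road to a dyadic `localTransferAtOne_of_hyperspecialLevel_le_one` (SIG-F5 v2 §4).  Seat LH4-p01 (g11).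
HONEST LABEL: HC_CM is proved only modulo the cell's 2 remaining named inputs (hLiu418 24832, h413 24833) until rung 0 closes; count-neutral: the `stub_N6nsDyadic` rider is the
desk's to price and needs the rest of the dyadic chain; this file asserts nothing printed — it is an assembly of ★ organs.

THE STATEMENT (`depthZeroKappaTransfer_hyperspecial_typeOne_of_isUnramifiedIn`) = ★ `depthZeroKappaTransfer_hyperspecial_typeOne` (`DepthZeroKappaTransferTypeOne` :67) with
the binder `h2 : IsUnit (2 : 𝒪_w)` (:75) DELETED; every other binder and the conclusion VERBATIM.
THE PROOF = the tame proof (:130–:234) call by call, with exactly two substitutions: Flicker's scalars ★ `exists_flicker_scalars_of_nonsplit … h2v` (`2e = 1`) ↦ the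
TRACE-FRAME scalars ★ `exists_traceFrame_scalars_of_nonsplit_sharp'` (`b + σb = 1`, `|b|_w = 1`, `|σb − b|_w = 1`, `σπ = π`, `π·π′ = 1`, `π` a non-norm, `σε·ε = −1`; LH4
price list (M1) «FLICKER'S REPRESENTATIVES RE-KEYED ON THE TRACE FRAME»), and the G-side ★ `…_of_split … h2e … h2` ↦ its trace-frame twin ★ p852274
`finsum_finExplicitDelta_mul_classOrbitalIntegral_depthZero_eq_of_split_trace_closed` ((C6)-6 CLOSED, LH4-plan (g7)); the near-1 locus, the integrality, the split exponents
★ `exists_flicker_exponents_split`, the eigenframe ★ `exists_eigenframe_cmDatum_local_of_isRoot_map_of_separable` ∕ ★ `forall_conjLocal_mul_eq_one_of_not_exists_conj_glDiagonal`,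
the H-side ★ O8c `stableOrbitalIntegralRel_chiZero_eq_mul_phiH_of_isRoot` ∕ `…chiOne…`, and the mass algebra are the tame lines VERBATIM (all 2-free).

## References
* [Rogawski1990] J. D. Rogawski, *Automorphic Representations of Unitary Groups in Three Variables*, Ann. of Math. Stud. 123 (1990): §4.9 Prop. 4.9.1 (a)(b) pp. 54–55,
  Lemma 4.9.3 p. 56; §4.3 (4.3.1)–(4.3.2) p. 43; §8.1 Prop. 8.1.1 p. 112.
* [Flicker1998UnitaryFL] Y. Z. Flicker, *Elementary proof of the fundamental lemma for a unitary group*, Canad. J. Math. 50 (1998): Prop. 3 p. 78, Props. 11–14 pp. 87–94,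
  §6 Thm. 15 p. 95.
* [LanglandsShelstad1987] R. P. Langlands, D. Shelstad, *On the definition of transfer factors*, Math. Ann. 278 (1987): §1.3–1.4.
* [Kottwitz1986BaseChangeUnits] R. Kottwitz, *Base change for unit elements of Hecke algebras*, Compositio Math. 60 (1986): §1 pp. 240–241.
-/

set_option autoImplicit false

noncomputable section

open MeasureTheory Measure Set Function NumberField IsDedekindDomain Matrix Polynomial Topology Filter
open Literature.NumberTheory.Automorphic Literature.NumberTheory.Automorphic.UnitaryGroup
open Literature.NumberTheory.Automorphic.IntegralReduction Literature.NumberTheory.GaloisRepresentations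
open scoped Matrix MatrixGroups ValuativeRel

namespace Literature.NumberTheory.Rogawski1990

/-! ## The assembly -/

set_option maxHeartbeats 800000 in
open scoped Classical in
/-- **T3′ HEAD v4, CLAUSE (P-1) TYPE ONE AT EVERY UNRAMIFIED NON-SPLIT PLACE** (the `|2|`-free twin of ★ `depthZeroKappaTransfer_hyperspecial_typeOne`: binders =
its binders with `h2 : IsUnit (2 : 𝒪_w)` DELETED, conclusion VERBATIM).  Proof = the tame proof with Flicker's scalars (`2e = 1`, ★ `exists_flicker_scalars_of_nonsplit … h2v`)
replaced by the TRACE-FRAME scalars (`b + σb = 1`, `|σb − b|_w = 1`; ★ `exists_traceFrame_scalars_of_nonsplit_sharp'`, any residue characteristic) and the G-side by its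
trace-frame twin ★ `finsum_finExplicitDelta_mul_classOrbitalIntegral_depthZero_eq_of_split_trace_closed` (p852274, (C6) CLOSED); H-side ★ O8c `…_of_isRoot` unchanged (2-free).
[cite: Rogawski1990, §4.9 Prop. 4.9.1 (a) p. 55; §4.3 (4.3.1)–(4.3.2) p. 43; §8.1 Prop. 8.1.1 p. 112] [cite: Flicker1998UnitaryFL, §6 Thm. 15 p. 95] [cite: LanglandsShelstad1987, §1.3–1.4]
[cite: Kottwitz1986BaseChangeUnits, §1 pp. 240–241] -/
theorem depthZeroKappaTransfer_hyperspecial_typeOne_of_isUnramifiedIn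
    (L : Type) [Field L] [NumberField L] [IsCMField L] (H' : Matrix (Fin 3) (Fin 3) L) (μ : HeckeCharacter L)
    {v : HeightOneSpectrum (𝓞 ↥(maximalRealSubfield L))}
    (hH' : (H'.map (cmConjRingHom L)).transpose = H') (w : PlacesOver L v)
    (hw : IsCMField.complexConj L • w.1 = w.1) (hv : Algebra.IsUnramifiedIn (𝓞 L) v.asIdeal)
    (hH'w : IsUnit (placeForm H' w.1)) (hH'i : hH'w.unit ∈ glInt 3 (w.1.adicCompletion L))
    (hμ : μ.IsUnramifiedAt w.1) (hμu : μ.IsUnitary)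
    (hμω : ∀ x : ideleGroup ↥(maximalRealSubfield L), μ (AdeleRing.ideleBaseChange ↥(maximalRealSubfield L) L x) = quadraticHeckeCharCM L x)
    [MeasurableSpace ((cmDatum L 3 H').Local v)] [BorelSpace ((cmDatum L 3 H').Local v)]
    [∀ γ : ((cmDatum L 3 H').Local v), MeasurableSpace (((cmDatum L 3 H').Local v) ⧸ Subgroup.centralizer ({γ} : Set ((cmDatum L 3 H').Local v)))]
    [∀ γ : ((cmDatum L 3 H').Local v), BorelSpace (((cmDatum L 3 H').Local v) ⧸ Subgroup.centralizer ({γ} : Set ((cmDatum L 3 H').Local v)))]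
    [MeasurableSpace ((cmDatum L 2 (Matrix.of fun i j : Fin 2 => if i.val + j.val + 1 = 2 then (1 : L) else 0)).Local v ×
      (cmDatum L 1 (Matrix.of fun i j : Fin 1 => if i.val + j.val + 1 = 1 then (1 : L) else 0)).Local v)]
    [BorelSpace ((cmDatum L 2 (Matrix.of fun i j : Fin 2 => if i.val + j.val + 1 = 2 then (1 : L) else 0)).Local v ×
      (cmDatum L 1 (Matrix.of fun i j : Fin 1 => if i.val + j.val + 1 = 1 then (1 : L) else 0)).Local v)]
    [∀ a : ((cmDatum L 2 (Matrix.of fun i j : Fin 2 => if i.val + j.val + 1 = 2 then (1 : L) else 0)).Local v ×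
      (cmDatum L 1 (Matrix.of fun i j : Fin 1 => if i.val + j.val + 1 = 1 then (1 : L) else 0)).Local v),
      MeasurableSpace (((cmDatum L 2 (Matrix.of fun i j : Fin 2 => if i.val + j.val + 1 = 2 then (1 : L) else 0)).Local v ×
      (cmDatum L 1 (Matrix.of fun i j : Fin 1 => if i.val + j.val + 1 = 1 then (1 : L) else 0)).Local v) ⧸ Subgroup.centralizer ({a} : Set ((cmDatum L 2 (Matrix.of fun i j : Fin 2 => if i.val + j.val + 1 = 2 then (1 : L) else 0)).Local v ×
      (cmDatum L 1 (Matrix.of fun i j : Fin 1 => if i.val + j.val + 1 = 1 then (1 : L) else 0)).Local v)))]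
    [∀ a : ((cmDatum L 2 (Matrix.of fun i j : Fin 2 => if i.val + j.val + 1 = 2 then (1 : L) else 0)).Local v ×
      (cmDatum L 1 (Matrix.of fun i j : Fin 1 => if i.val + j.val + 1 = 1 then (1 : L) else 0)).Local v),
      BorelSpace (((cmDatum L 2 (Matrix.of fun i j : Fin 2 => if i.val + j.val + 1 = 2 then (1 : L) else 0)).Local v ×
      (cmDatum L 1 (Matrix.of fun i j : Fin 1 => if i.val + j.val + 1 = 1 then (1 : L) else 0)).Local v) ⧸ Subgroup.centralizer ({a} : Set ((cmDatum L 2 (Matrix.of fun i j : Fin 2 => if i.val + j.val + 1 = 2 then (1 : L) else 0)).Local v ×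
      (cmDatum L 1 (Matrix.of fun i j : Fin 1 => if i.val + j.val + 1 = 1 then (1 : L) else 0)).Local v)))]
    (νH : Measure ((cmDatum L 2 (Matrix.of fun i j : Fin 2 => if i.val + j.val + 1 = 2 then (1 : L) else 0)).Local v ×
      (cmDatum L 1 (Matrix.of fun i j : Fin 1 => if i.val + j.val + 1 = 1 then (1 : L) else 0)).Local v)) [νH.IsHaarMeasure] [νH.IsMulRightInvariant]
    (νG : Measure ((cmDatum L 3 H').Local v)) [νG.IsHaarMeasure] [νG.IsMulRightInvariant]
    {mH : OrbitalMeasureFamily ((cmDatum L 2 (Matrix.of fun i j : Fin 2 => if i.val + j.val + 1 = 2 then (1 : L) else 0)).Local v ×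
      (cmDatum L 1 (Matrix.of fun i j : Fin 1 => if i.val + j.val + 1 = 1 then (1 : L) else 0)).Local v)} {mG : OrbitalMeasureFamily ((cmDatum L 3 H').Local v)}
    (hmH : mH.IsCanonical (IsLocalGRegular L v) νH)
    (hmG : mG.IsCanonical (fun γ => IsRegularElt (γ.val : GL (Fin 3) (UnitaryGroup.LocalRing L v))) νG)
    -- the depth-zero piece at the hyperspecial vertex: `C_c^∞`, supported in `K`, constant on the residually-unipotent Jordan strata of `K`
    (g : ((cmDatum L 3 H').Local v) → ℂ) (hg : IsLocSmooth g) (hgK : tsupport g ⊆ (cmLocalIntegralLevel L 3 H' v : Set ((cmDatum L 3 H').Local v)))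
    (hginv : ∀ u ∈ cmLocalIntegralLevel L 3 H' v, ∀ x, g (u * x * u⁻¹) = g x)
    (c : ℕ → ℂ)
    (hc : ∀ k ∈ cmLocalIntegralLevel L 3 H' v,
      (redMat (((k.val : GL (Fin 3) (UnitaryGroup.LocalRing L v)).val.map (Pi.evalRingHom (fun w' : PlacesOver L v => w'.1.adicCompletion L) w))) - 1) ^ 3 = 0 →
      g k = c (redMat (((k.val : GL (Fin 3) (UnitaryGroup.LocalRing L v)).val.map (Pi.evalRingHom (fun w' : PlacesOver L v => w'.1.adicCompletion L) w))) - 1).rank) :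
    ∃ V ∈ 𝓝 (1 : ((cmDatum L 2 (Matrix.of fun i j : Fin 2 => if i.val + j.val + 1 = 2 then (1 : L) else 0)).Local v ×
        (cmDatum L 1 (Matrix.of fun i j : Fin 1 => if i.val + j.val + 1 = 1 then (1 : L) else 0)).Local v)),
      ∀ γH ∈ V, IsLocalGRegular L v γH →
        (∃ x : w.1.adicCompletion L, (((γH.1.val : GL (Fin 2) (UnitaryGroup.LocalRing L v)).val.map
          (Pi.evalRingHom (fun w' : PlacesOver L v => w'.1.adicCompletion L) w)).charpoly).IsRoot x) →
        ¬ (∃ (y : ((cmDatum L 2 (Matrix.of fun i j : Fin 2 => if i.val + j.val + 1 = 2 then (1 : L) else 0)).Local v ×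
        (cmDatum L 1 (Matrix.of fun i j : Fin 1 => if i.val + j.val + 1 = 1 then (1 : L) else 0)).Local v)) (d' : Fin 2 → (UnitaryGroup.LocalRing L v)ˣ),
          glDiagonal 2 (UnitaryGroup.LocalRing L v) d' = ((y * γH * y⁻¹).1.val : GL (Fin 2) (UnitaryGroup.LocalRing L v))) →
        ∑ᶠ cG : ConjClasses ((cmDatum L 3 H').Local v),
            ((finExplicitCollection L H' μ (finExplicitDelta_conj_left_all L H' μ) (finExplicitDelta_conj_right_all L H' μ)) v).Δ γH (Quotient.out cG) *
              classOrbitalIntegral mG g cG =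
          -- `a₀ · Φ^st(γH, χ₀)`, `a₀ = (ν_G(K)∕ν_H(K_H)) · (q⁻² c 0 + ((q²−1)∕q²) c 1)`, `χ₀ = 1_{{h ∈ K_H : h̄_W = 1}}`
          ((νG.real (cmLocalIntegralLevel L 3 H' v : Set ((cmDatum L 3 H').Local v)) / νH.real (((cmLocalIntegralLevel L 2 (Matrix.of fun i j : Fin 2 => if i.val + j.val + 1 = 2 then (1 : L) else 0) v).prod
                (cmLocalIntegralLevel L 1 (Matrix.of fun i j : Fin 1 => if i.val + j.val + 1 = 1 then (1 : L) else 0) v) : Subgroup _) : Set _) : ℝ) : ℂ) * (((Ideal.absNorm v.asIdeal : ℂ) ^ 2)⁻¹ * c 0 + (((Ideal.absNorm v.asIdeal : ℂ) ^ 2 - 1) / (Ideal.absNorm v.asIdeal : ℂ) ^ 2) * c 1) *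
              stableOrbitalIntegralRel (IsLocalStablyConjH L v) mH
                ((((cmLocalIntegralLevel L 2 (Matrix.of fun i j : Fin 2 => if i.val + j.val + 1 = 2 then (1 : L) else 0) v).prod
                (cmLocalIntegralLevel L 1 (Matrix.of fun i j : Fin 1 => if i.val + j.val + 1 = 1 then (1 : L) else 0) v) : Subgroup _) : Set _).indicator
              (fun h => if (redMat (((h.1.val : GL (Fin 2) (UnitaryGroup.LocalRing L v)).val.map (Pi.evalRingHom (fun w' : PlacesOver L v => w'.1.adicCompletion L) w))) - 1) ^ 2 = 0 ∧ (redMat (((h.1.val : GL (Fin 2) (UnitaryGroup.LocalRing L v)).val.map (Pi.evalRingHom (fun w' : PlacesOver L v => w'.1.adicCompletion L) w))) - 1).rank = 0 then (1 : ℂ) else 0)) γH +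
          -- `a₁ · Φ^st(γH, χ₁)`, `a₁ = (ν_G(K)∕ν_H(K_H)) · (−q⁻¹ c 1 + ((q+1)∕q) c 2)`, `χ₁ = 1_{{h ∈ K_H : h̄_W unipotent, rank(h̄_W − 1) = 1}}`
          ((νG.real (cmLocalIntegralLevel L 3 H' v : Set ((cmDatum L 3 H').Local v)) / νH.real (((cmLocalIntegralLevel L 2 (Matrix.of fun i j : Fin 2 => if i.val + j.val + 1 = 2 then (1 : L) else 0) v).prod
                (cmLocalIntegralLevel L 1 (Matrix.of fun i j : Fin 1 => if i.val + j.val + 1 = 1 then (1 : L) else 0) v) : Subgroup _) : Set _) : ℝ) : ℂ) * (-((Ideal.absNorm v.asIdeal : ℂ))⁻¹ * c 1 + (((Ideal.absNorm v.asIdeal : ℂ) + 1) / (Ideal.absNorm v.asIdeal : ℂ)) * c 2) *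
              stableOrbitalIntegralRel (IsLocalStablyConjH L v) mH
                ((((cmLocalIntegralLevel L 2 (Matrix.of fun i j : Fin 2 => if i.val + j.val + 1 = 2 then (1 : L) else 0) v).prod
                (cmLocalIntegralLevel L 1 (Matrix.of fun i j : Fin 1 => if i.val + j.val + 1 = 1 then (1 : L) else 0) v) : Subgroup _) : Set _).indicator
              (fun h => if (redMat (((h.1.val : GL (Fin 2) (UnitaryGroup.LocalRing L v)).val.map (Pi.evalRingHom (fun w' : PlacesOver L v => w'.1.adicCompletion L) w))) - 1) ^ 2 = 0 ∧ (redMat (((h.1.val : GL (Fin 2) (UnitaryGroup.LocalRing L v)).val.map (Pi.evalRingHom (fun w' : PlacesOver L v => w'.1.adicCompletion L) w))) - 1).rank = 1 then (1 : ℂ) else 0)) γH := by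
  haveI := Literature.NumberTheory.Automorphic.isAdicComplete_maximalIdeal_valuedInteger_adicCompletion L w.1
  have _hμu := hμu  -- a binder of the clause text (HEAD v4 VERBATIM) not needed by the proof
  have hH'σ : (H'.map (IsCMField.complexConj L))ᵀ = H' := hH'
  have hq : 1 < Ideal.absNorm v.asIdeal :=
    Nat.one_lt_iff_ne_zero_and_ne_one.2 ⟨by rw [Ne, Ideal.absNorm_eq_zero_iff]; exact v.ne_bot,
      by rw [Ne, Ideal.absNorm_eq_one_iff]; exact v.isPrime.ne_top⟩
  have hiso := ValuativeRel.isEquiv (ValuativeRel.valuation (w.1.adicCompletion L))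
    (Valued.v : Valuation (w.1.adicCompletion L) (WithZero (Multiplicative ℤ)))
  -- `H′` is invertible: its image over `L_w` is
  have hH'u : IsUnit H' := by
    rw [Matrix.isUnit_iff_isUnit_det]
    have h := (Matrix.isUnit_iff_isUnit_det _).1 hH'w
    rw [show placeForm H' w.1 = (algebraMap L (w.1.adicCompletion L)).mapMatrix H' from rfl, ← RingHom.map_det] at h
    exact isUnit_iff_ne_zero.2 fun h0 => h.ne_zero (by rw [h0, map_zero])
  -- the masses
  have hKHpos : νH.real ((cmLocalIntegralLevel L 2 (Matrix.of fun i j : Fin 2 => if i.val + j.val + 1 = 2 then (1 : L) else 0) v :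
        Set ((cmDatum L 2 (Matrix.of fun i j : Fin 2 => if i.val + j.val + 1 = 2 then (1 : L) else 0)).Local v)) ×ˢ
      (cmLocalIntegralLevel L 1 (Matrix.of fun i j : Fin 1 => if i.val + j.val + 1 = 1 then (1 : L) else 0) v :
        Set ((cmDatum L 1 (Matrix.of fun i j : Fin 1 => if i.val + j.val + 1 = 1 then (1 : L) else 0)).Local v))) ≠ 0 := by
    have hK2 := isCompact_isOpen_cmLocalIntegralLevel L 2 (Matrix.of fun i j : Fin 2 => if i.val + j.val + 1 = 2 then (1 : L) else 0) v
    have hK1 := isCompact_isOpen_cmLocalIntegralLevel L 1 (Matrix.of fun i j : Fin 1 => if i.val + j.val + 1 = 1 then (1 : L) else 0) v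
    rw [measureReal_def]
    exact (ENNReal.toReal_pos ((hK2.2.prod hK1.2).measure_pos νH ⟨(1, 1), Subgroup.one_mem _, Subgroup.one_mem _⟩).ne'
      (hK2.1.prod hK1.1).measure_lt_top.ne).ne'
  -- (0) the neighbourhood: the residually-unipotent locus of `ι_v`
  refine ⟨_, setOf_residuallyUnipotent_endoEmbLocal_mem_nhds_one L v w, ?_⟩
  intro γH hγV hreg hsplit hlev
  simp only [Set.mem_setOf_eq] at hγV
  -- keep the (large) goal out of the eliminators' motives while gathering the data; it comes back at `apply hneg`
  by_contra hneg
  -- integrality of `charpoly(ι_v γ_H)_w` in both currencies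
  have hintV : ∀ i : ℕ, ((((endoEmbLocal L v γH).val : GL (Fin 3) (UnitaryGroup.LocalRing L v)).val.map
      (Pi.evalRingHom (fun w' : PlacesOver L v => w'.1.adicCompletion L) w)).charpoly.coeff i) ∈ Valued.integer (w.1.adicCompletion L) :=
    fun i => (Valuation.mem_integer_iff _ _).2 (v_charpoly_coeff_le_one_of_residuallyUnipotent _ hγV i)
  have hint : ∀ i : ℕ, ((((endoEmbLocal L v γH).val : GL (Fin 3) (LocalRing L v)).val.map
      (Pi.evalRingHom (fun w' : PlacesOver L v => w'.1.adicCompletion L) w)).charpoly.coeff i) ∈ 𝒪[w.1.adicCompletion L] :=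
    fun i => (Valuation.mem_integer_iff _ _).2 ((hiso.le_one_iff_le_one).2 ((Valuation.mem_integer_iff _ _).1 (hintV i)))
  -- (1) the split eigen-data and Flicker's exponents
  obtain ⟨α, γ, N₁, N₂, N, hα, hγ, hαγ, hN₁, hN₂, hN, htri⟩ := exists_flicker_exponents_split L v w hw hreg hintV hsplit
  -- DEEPNESS: the three eigenvalues `α, γ, u_w` of `ι_v(γ_H)_w` are `≡ 1 (mod 𝔪_w)`
  have hfac := charpoly_map_endoEmbLocal_apply L w (γH := γH)
  have hcm : ((((γH.1.val : GL (Fin 2) (LocalRing L v)).val).map (Pi.evalRingHom (fun w' : PlacesOver L v => w'.1.adicCompletion L) w))).charpoly =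
      ((((γH.1.val : GL (Fin 2) (LocalRing L v)) : Matrix (Fin 2) (Fin 2) (LocalRing L v)).charpoly).map
        (Pi.evalRingHom (fun w' : PlacesOver L v => w'.1.adicCompletion L) w)) := Matrix.charpoly_map _ _
  have hα1 : Valued.v (α - 1) < 1 := by
    refine valuation_sub_one_lt_one_of_isRoot_charpoly_of_residuallyUnipotent _ hγV ?_
    rw [hfac, Polynomial.IsRoot, eval_mul, hcm, hα.eq_zero, zero_mul]
  have hγ1 : Valued.v (γ - 1) < 1 := by
    refine valuation_sub_one_lt_one_of_isRoot_charpoly_of_residuallyUnipotent _ hγV ?_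
    rw [hfac, Polynomial.IsRoot, eval_mul, hcm, hγ.eq_zero, zero_mul]
  have hb1 : Valued.v (finGammaTwo L v γH w - 1) < 1 := by
    refine valuation_sub_one_lt_one_of_isRoot_charpoly_of_residuallyUnipotent _ hγV ?_
    rw [hfac, Polynomial.IsRoot, eval_mul, eval_sub, eval_X, eval_C, sub_self, mul_zero]
  -- (2) the TRACE-FRAME scalars (2-free, ★ `exists_traceFrame_scalars_of_nonsplit_sharp'`) and an eigenframe of `g` with norm-one eigenvalues `u 0 (w) = α`, `u 1 (w) = γ`
  obtain ⟨b, π, π', ε, hb, hvb, hbδ, hσπ, hππ, hπN, -, hε⟩ := exists_traceFrame_scalars_of_nonsplit_sharp' L v w hw hv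
  have hsep : (((γH.1.val : GL (Fin 2) (LocalRing L v)) : Matrix (Fin 2) (Fin 2) (LocalRing L v)).charpoly).Separable :=
    (isRegularElt_fst_snd_of_isLocalGRegular L v γH hreg).1
  obtain ⟨P₂, u, hP₂, hu, hu0⟩ := exists_eigenframe_cmDatum_local_of_isRoot_map_of_separable L v w hw γH.1 hα hsep
  have hu1w : u 1 w = γ := by
    rcases eq_or_eq_eval_of_isRoot_of_eigenframe L v w hP₂ hγ with h | h
    · exact absurd (h.trans hu0) (Ne.symm hαγ)
    · exact h.symm
  have hu1 : ∀ i, conjLocal L (IsCMField.complexConj L) v (u i) * u i = 1 :=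
    forall_conjLocal_mul_eq_one_of_not_exists_conj_glDiagonal L v w hw hP₂ hu hlev
  have hP₂' : (γH.1.val.val : Matrix (Fin 2) (Fin 2) (LocalRing L v)) * P₂.val = P₂.val * diagonal ![u 0, u 1] := by
    rw [hP₂]; congr 1; ext i j; fin_cases i <;> fin_cases j <;> rfl
  have hαb : α ≠ finGammaTwo L v γH w := fun h0 => by
    rw [h0, sub_self, map_zero] at hN₁; exact WithZero.zero_ne_coe hN₁
  have hγb : γ ≠ finGammaTwo L v γH w := fun h0 => by
    rw [h0, sub_self, map_zero] at hN₂; exact WithZero.zero_ne_coe hN₂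
  have had : u 0 ≠ u 1 := fun h => zero_ne_one (hu h)
  have hab : u 0 ≠ finGammaTwo L v γH := fun h => hαb (by rw [← hu0, h])
  have hbd : finGammaTwo L v γH ≠ u 1 := fun h => hγb (by rw [← hu1w, ← h])
  -- (3)–(6) the G-side in the trace frame (★ p852274, CLOSED) and the H-side values ★ O8c, then the mass algebra
  apply hneg
  rw [finsum_finExplicitDelta_mul_classOrbitalIntegral_depthZero_eq_of_split_trace_closed L H' hH'σ w hw hv hH'w hH'i μ hμ
      (finExplicitDelta_conj_left_all L H' μ) (finExplicitDelta_conj_right_all L H' μ) hH'u hμω α γ N₁ N₂ hα hγ hαγ hN₁ hN₂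
      hb hσπ hππ hπN hvb.le hbδ hε (hu1 0) (hu1 1) hP₂' had hab hbd hu0 hu1w N hN htri hα1 hγ1 hb1 νG hmG g hg hgK hginv c hc,
    stableOrbitalIntegralRel_chiZero_eq_mul_phiH_of_isRoot L v w hw νH hv hmH hreg hlev α γ hα hγ hαγ N hN hα1 hγ1 _,
    stableOrbitalIntegralRel_chiOne_eq_mul_phiH_sub_of_isRoot L v w hw νH hv hmH hreg hlev α γ hα hγ hαγ N hN hα1 hγ1 _ _]
  have hKHc := Complex.ofReal_ne_zero.2 hKHpos
  push_cast
  field_simp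
  -- what is left: the decidability binders of ★ O8c's `χ₀`, `χ₁` (any instances)
  all_goals exact fun _ => inferInstance

end Literature.NumberTheory.Rogawski1990

end
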